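import Literature.NumberTheory.NumberFields.SplitPrimesGaloisClosure
import Mathlib.NumberTheory.RamificationInertia.Valuation
import Mathlib.NumberTheory.NumberField.ClassNumber
import Mathlib.Data.Fintype.Pigeonhole
import HarnessLib

/-!
# Square classes of a number field relative to a proper subfield

For a nontrivial extension of number fields `K ⊊ E` the group `E^× / (K^× · (E^×)²)` is infinite.
We prove the following concrete form, which is what the kernel proof of [AbsAnab] Thm 1.1.2
(`Literature/AnabelianGeometry/AbsoluteAnabelian/NFGaloisTFGNormalProofs.lean`) consumes:

* `exists_seq_not_mem_relSquareClass` — there is a sequence `f : ℕ → E` such that no `f n` and no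
  product `f m * f n` (`m ≠ n`) is of the form `q · c²` with `q ∈ K`, `c ∈ E`.

Proof (classical; Marcus, *Number Fields*, Ch. 3–4 material): by the tree's Chebotarev-based
`infinite_setOf_splitsCompletely` infinitely many rational primes `p` split completely in `E`; above
such a `p` the `[E:ℚ] > [K:ℚ]` primes of `E` cannot lie over pairwise distinct primes of `K`, so two
of them, `𝔔₁ ≠ 𝔔₂`, lie over one prime `𝔮` of `K`, with ramification index `1`; hence
`w_{𝔔₁}(q) = w_𝔮(q) = w_{𝔔₂}(q)` for `q ∈ K` (Mathlib `valuation_liesOver`), and an element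
`a = q c²` has `w_{𝔔₁}(a) ≡ w_{𝔔₂}(a) (mod 2)` (`even_sub_of_eq_mul_sq`).  By finiteness of the class
group, infinitely many of these `p` have `𝔔₁(p)` in one ideal class; fixing `p₀` among them,
`𝔔₁(p) · 𝔔₁(p₀)^{h-1} = (π_p)` is principal, and `π_p` has valuations `1` at `𝔔₁(p)`, `0` at
`𝔔₂(p)` and `0` above every other such prime `p' ≠ p₀` — so `π_p` and `π_p π_{p'}` have odd
valuation difference at `(𝔔₁(p), 𝔔₂(p))`.

Classical algebraic number theory; nothing here is specific to, or takes a side on, the disputed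
corpus ([IUTchI–IV]). [cite: Marcus2018, Ch. 4 (before Thm. 29)]
-/

noncomputable section

open NumberField IsDedekindDomain Ideal WithZero
open scoped Classical nonZeroDivisors

namespace Literature.NumberTheory.NumberFields

open Literature.NumberTheory.GaloisRepresentations

variable {K E : Type} [Field K] [NumberField K] [Field E] [NumberField E] [Algebra K E]

/-! ### §1. The local obstruction: two primes of `E` over one prime of `K`, both unramified -/

/-- **Parity obstruction.**  Let `w₁, w₂` be finite places of `E` over the same finite place `v`
of `K`, both with ramification index `1` over `v`.  If `a = q · c²` with `q ∈ K^×`, `c ∈ E^×`, then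
the integer `log w₁(a) − log w₂(a)` is even (`w_i(q) = v(q)` by Mathlib `valuation_liesOver`).
[cite: Marcus2018, Ch. 4 (before Thm. 29)] -/
theorem even_sub_of_eq_mul_sq (v : HeightOneSpectrum (𝓞 K)) (w₁ w₂ : HeightOneSpectrum (𝓞 E))
    [w₁.asIdeal.LiesOver v.asIdeal] [w₂.asIdeal.LiesOver v.asIdeal]
    (he₁ : v.asIdeal.ramificationIdx' w₁.asIdeal = 1)
    (he₂ : v.asIdeal.ramificationIdx' w₂.asIdeal = 1) {a : E} {q : K} {c : E} (hq : q ≠ 0)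
    (hc : c ≠ 0) (h : a = algebraMap K E q * c ^ 2) :
    Even (log (w₁.valuation E a) - log (w₂.valuation E a)) := by
  have h1 := HeightOneSpectrum.valuation_liesOver E v w₁ q
  have h2 := HeightOneSpectrum.valuation_liesOver E v w₂ q
  rw [he₁, pow_one] at h1
  rw [he₂, pow_one] at h2
  subst h
  have hq' : algebraMap K E q ≠ 0 := (map_ne_zero _).mpr hq
  have hvq : v.valuation K q ≠ 0 := (Valuation.ne_zero_iff _).mpr hq
  have hc₁ : w₁.valuation E c ≠ 0 := (Valuation.ne_zero_iff _).mpr hc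
  have hc₂ : w₂.valuation E c ≠ 0 := (Valuation.ne_zero_iff _).mpr hc
  rw [map_mul, map_mul, map_pow, map_pow, ← h1, ← h2, log_mul hvq (pow_ne_zero 2 hc₁),
    log_mul hvq (pow_ne_zero 2 hc₂), log_pow, log_pow]
  exact ⟨log (w₁.valuation E c) - log (w₂.valuation E c), by simp only [nsmul_eq_mul]; ring⟩

/-- The parity obstruction in the form used below: an element whose valuation difference at
`(w₁, w₂)` is odd is not of the form `q · c²` (`q ∈ K`, `c ∈ E`).
[cite: Marcus2018, Ch. 4 (before Thm. 29)] -/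
theorem not_exists_eq_mul_sq_of_odd (v : HeightOneSpectrum (𝓞 K)) (w₁ w₂ : HeightOneSpectrum (𝓞 E))
    [w₁.asIdeal.LiesOver v.asIdeal] [w₂.asIdeal.LiesOver v.asIdeal]
    (he₁ : v.asIdeal.ramificationIdx' w₁.asIdeal = 1)
    (he₂ : v.asIdeal.ramificationIdx' w₂.asIdeal = 1) {a : E}
    (hodd : Odd (log (w₁.valuation E a) - log (w₂.valuation E a))) :
    ¬ ∃ (q : K) (c : E), a = algebraMap K E q * c ^ 2 := by
  rintro ⟨q, c, h⟩
  have ha : a ≠ 0 := by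
    rintro rfl
    simp at hodd
  have hq : q ≠ 0 := by
    rintro rfl
    exact ha (by rw [h]; simp)
  have hc : c ≠ 0 := by
    rintro rfl
    exact ha (by rw [h]; simp)
  exact (Int.not_even_iff_odd.mpr hodd) (even_sub_of_eq_mul_sq v w₁ w₂ he₁ he₂ hq hc h)

/-! ### §2. Two primes of `E` above one prime of `K`, below a completely split rational prime -/

/-- Above a rational prime `p` that splits completely in `E`, with `[K : ℚ] < [E : ℚ]`, there are two
distinct primes `𝔔₁ ≠ 𝔔₂` of `E` lying over ONE prime of `K`, both with ramification index `1`
over it (pigeonhole on `𝔔 ↦ 𝔔 ∩ 𝓞_K`: `[E : ℚ]` primes of `E` above `p` by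
`ncard_primesOver_eq_finrank_of_splitsCompletely`, at most `[K : ℚ]` primes of `K` above `p` by
Mathlib `Ideal.card_primesOverFinset_le_finrank`; `e = 1` over `ℤ` forces `e = 1` over `𝓞_K`).
[cite: Marcus2018, Ch. 4 (before Thm. 29)] -/
theorem exists_two_primes_over_one (hlt : Module.finrank ℚ K < Module.finrank ℚ E) {p : ℕ}
    (hp : p.Prime) (hsplit : SplitsCompletely E p) :
    ∃ (v : HeightOneSpectrum (𝓞 K)) (w₁ w₂ : HeightOneSpectrum (𝓞 E)),
      w₁ ≠ w₂ ∧ (p : 𝓞 E) ∈ w₁.asIdeal ∧ (p : 𝓞 E) ∈ w₂.asIdeal ∧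
      w₁.asIdeal.LiesOver v.asIdeal ∧ w₂.asIdeal.LiesOver v.asIdeal ∧
      v.asIdeal.ramificationIdx' w₁.asIdeal = 1 ∧ v.asIdeal.ramificationIdx' w₂.asIdeal = 1 := by
  have hp0 : span {(p : ℤ)} ≠ ⊥ := by
    rw [ne_eq, span_singleton_eq_bot]; exact_mod_cast hp.ne_zero
  haveI hprime : (span {(p : ℤ)}).IsPrime :=
    (span_singleton_prime (by exact_mod_cast hp.ne_zero)).mpr (Nat.prime_iff_prime_int.mp hp)
  haveI hmax : (span {(p : ℤ)}).IsMaximal := hprime.isMaximal hp0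
  obtain ⟨hunr, -⟩ := (splitsCompletely_iff_forall_inertiaDeg_eq_one hp).mp hsplit
  -- the finite sets of primes above `p`
  set PE := IsDedekindDomain.primesOverFinset (span {(p : ℤ)}) (𝓞 E) with hPE
  set PK := IsDedekindDomain.primesOverFinset (span {(p : ℤ)}) (𝓞 K) with hPK
  have hcardE : PE.card = Module.finrank ℚ E := by
    rw [← ncard_primesOver_eq_finrank_of_splitsCompletely hp hsplit,
      ← IsDedekindDomain.coe_primesOverFinset hp0 (𝓞 E), Set.ncard_coe_finset]
  have hcardK : PK.card ≤ Module.finrank ℚ K :=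
    Ideal.card_primesOverFinset_le_finrank (𝓞 K) ℚ K hp0
  -- `𝔔 ↦ 𝔔 ∩ 𝓞_K` maps `PE` to `PK`
  have hmaps : ∀ Q ∈ PE, Q.under (𝓞 K) ∈ PK := by
    intro Q hQ
    rw [hPE, IsDedekindDomain.mem_primesOverFinset_iff hp0] at hQ
    haveI := hQ.1
    haveI := hQ.2
    rw [hPK, IsDedekindDomain.mem_primesOverFinset_iff hp0]
    refine ⟨inferInstance, ?_⟩
    haveI : Q.LiesOver (Q.under (𝓞 K)) := ⟨rfl⟩
    exact Ideal.LiesOver.tower_bot Q (Q.under (𝓞 K)) (span {(p : ℤ)})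
  have hlt' : PK.card < PE.card := by rw [hcardE]; exact lt_of_le_of_lt hcardK hlt
  obtain ⟨Q₁, hQ₁, Q₂, hQ₂, hne, hunder⟩ :=
    Finset.exists_ne_map_eq_of_card_lt_of_maps_to hlt' hmaps
  rw [hPE, IsDedekindDomain.mem_primesOverFinset_iff hp0] at hQ₁ hQ₂
  haveI := hQ₁.1
  haveI := hQ₁.2
  haveI := hQ₂.1
  haveI := hQ₂.2
  have hQ₁ne : Q₁ ≠ ⊥ := ne_bot_of_liesOver_of_ne_bot hp0 Q₁
  have hQ₂ne : Q₂ ≠ ⊥ := ne_bot_of_liesOver_of_ne_bot hp0 Q₂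
  set q : Ideal (𝓞 K) := Q₁.under (𝓞 K) with hqdef
  haveI : q.IsPrime := inferInstance
  haveI hq₁ : Q₁.LiesOver q := ⟨rfl⟩
  haveI hq₂ : Q₂.LiesOver q := ⟨hunder⟩
  haveI : q.LiesOver (span {(p : ℤ)}) := Ideal.LiesOver.tower_bot Q₁ q (span {(p : ℤ)})
  have hqne : q ≠ ⊥ := ne_bot_of_liesOver_of_ne_bot hp0 q
  let v : HeightOneSpectrum (𝓞 K) := ⟨q, inferInstance, hqne⟩
  let w₁ : HeightOneSpectrum (𝓞 E) := ⟨Q₁, inferInstance, hQ₁ne⟩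
  let w₂ : HeightOneSpectrum (𝓞 E) := ⟨Q₂, inferInstance, hQ₂ne⟩
  -- ramification index `1` over `𝓞_K`: unramified over `ℤ` ⇒ unramified over `𝓞_K`
  have hram : ∀ (Q : Ideal (𝓞 E)) [Q.IsPrime] [Q.LiesOver (span {(p : ℤ)})] [Q.LiesOver q],
      q.ramificationIdx' Q = 1 := by
    intro Q _ _ _
    haveI : Algebra.IsUnramifiedAt ℤ Q := hunr Q inferInstance inferInstance
    haveI : Algebra.IsUnramifiedAt (𝓞 K) Q := Algebra.IsUnramifiedAt.of_restrictScalars ℤ Q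
    rw [Ideal.ramificationIdx'_eq_ramificationIdx q Q hqne]
    exact Ideal.ramificationIdx_eq_one_of_isUnramifiedAt
  have hpQ : ∀ (Q : Ideal (𝓞 E)) [Q.LiesOver (span {(p : ℤ)})], (p : 𝓞 E) ∈ Q := by
    intro Q hQ
    have h1 : (p : ℤ) ∈ Q.under ℤ := by
      rw [← hQ.over]; exact mem_span_singleton_self _
    rw [under_def, mem_comap, map_natCast] at h1
    exact h1
  refine ⟨v, w₁, w₂, ?_, hpQ Q₁, hpQ Q₂, hq₁, hq₂, hram Q₁, hram Q₂⟩
  intro h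
  exact hne (congrArg HeightOneSpectrum.asIdeal h)

/-! ### §3. Valuations of a generator of `𝔔₁ · 𝔔₀^(h-1)` -/

omit [NumberField E] in
/-- Primes of `𝓞 E` containing distinct rational primes are distinct. [folklore] -/
private theorem ne_of_natCast_mem {p p' : ℕ} (hp : p.Prime) (hp' : p'.Prime) (hne : p ≠ p')
    {w w' : HeightOneSpectrum (𝓞 E)} (h : (p : 𝓞 E) ∈ w.asIdeal) (h' : (p' : 𝓞 E) ∈ w'.asIdeal) :
    w ≠ w' := by
  rintro rfl
  have hcop : IsCoprime (p : ℤ) (p' : ℤ) :=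
    Nat.isCoprime_iff_coprime.mpr ((Nat.coprime_primes hp hp').mpr hne)
  obtain ⟨a, b, hab⟩ := hcop
  have h1 : (1 : 𝓞 E) ∈ w.asIdeal := by
    have hab' := congrArg (Int.cast : ℤ → 𝓞 E) hab
    push_cast at hab'
    rw [← hab']
    exact w.asIdeal.add_mem (w.asIdeal.mul_mem_left _ h) (w.asIdeal.mul_mem_left _ h')
  exact w.isPrime.ne_top ((Ideal.eq_top_iff_one _).mpr h1)

/-- `log` of the valuation of a generator of `Q₁ * J` at a prime `w`: `-1` at `w = Q₁` when
`Q₁ ∤ J`, and `0` at primes dividing neither `Q₁` nor `J`. [folklore] -/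
private theorem log_valuation_eq_neg_one {w : HeightOneSpectrum (𝓞 E)} {J : Ideal (𝓞 E)}
    {π : 𝓞 E} (hπ : Ideal.span {π} = w.asIdeal * J) (hJ : ¬ w.asIdeal ∣ J) :
    log (w.valuation E (algebraMap (𝓞 E) E π)) = -1 := by
  have hπ0 : π ≠ 0 := by
    rintro rfl
    rw [Ideal.span_singleton_eq_bot.mpr rfl, eq_comm, Ideal.mul_eq_bot] at hπ
    rcases hπ with h | h
    · exact w.ne_bot h
    · exact hJ (h ▸ dvd_zero _)
  rw [HeightOneSpectrum.valuation_of_algebraMap, HeightOneSpectrum.intValuation_eq_exp_neg_multiplicity w hπ0,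
    log_exp, neg_inj]
  have hfin : FiniteMultiplicity w.asIdeal (Ideal.span {π}) :=
    FiniteMultiplicity.of_prime_left w.prime (Ideal.span_singleton_eq_bot.not.mpr hπ0)
  have h1 : w.asIdeal ^ 1 ∣ Ideal.span {π} := by rw [pow_one, hπ]; exact dvd_mul_right _ _
  have h2 : ¬ w.asIdeal ^ 2 ∣ Ideal.span {π} := by
    rw [hπ, pow_two]
    intro h
    exact hJ ((mul_dvd_mul_iff_left w.ne_bot).mp h)
  have hle : 1 ≤ multiplicity w.asIdeal (Ideal.span {π}) := hfin.le_multiplicity_of_pow_dvd h1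
  have hlt : multiplicity w.asIdeal (Ideal.span {π}) < 2 :=
    (hfin.multiplicity_lt_iff_not_dvd).mpr h2
  omega

/-- … and `0` at a prime dividing neither factor. [folklore] -/
private theorem log_valuation_eq_zero {w : HeightOneSpectrum (𝓞 E)} {I : Ideal (𝓞 E)}
    {π : 𝓞 E} (hπ : Ideal.span {π} = I) (hI : ¬ w.asIdeal ∣ I) :
    log (w.valuation E (algebraMap (𝓞 E) E π)) = 0 := by
  have h : w.valuation E (algebraMap (𝓞 E) E π) = 1 := by
    rw [HeightOneSpectrum.valuation_of_algebraMap, HeightOneSpectrum.intValuation_eq_one_iff]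
    intro hmem
    exact hI (hπ ▸ (Ideal.dvd_span_singleton.mpr hmem))
  rw [h, log_one]

/-- A prime of a Dedekind domain dividing another is equal to it. [folklore] -/
private theorem eq_of_dvd {w w' : HeightOneSpectrum (𝓞 E)} (h : w.asIdeal ∣ w'.asIdeal) : w = w' := by
  have hle : w'.asIdeal ≤ w.asIdeal := Ideal.le_of_dvd h
  have hmax : w'.asIdeal.IsMaximal := w'.isPrime.isMaximal w'.ne_bot
  exact HeightOneSpectrum.ext (hmax.eq_of_le w.isPrime.ne_top hle).symm

/-- A prime dividing `Q₁ * Q₀ ^ n` is `Q₁` or `Q₀`. [folklore] -/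
private theorem eq_or_eq_of_dvd_mul_pow {w w₁ w₀ : HeightOneSpectrum (𝓞 E)} {n : ℕ}
    (h : w.asIdeal ∣ w₁.asIdeal * w₀.asIdeal ^ n) : w = w₁ ∨ w = w₀ := by
  rcases w.prime.dvd_or_dvd h with h | h
  · exact Or.inl (eq_of_dvd h)
  · exact Or.inr (eq_of_dvd (w.prime.dvd_of_dvd_pow h))

/-! ### §4. The sequence -/

/-- **Relative square classes are infinite, concretely.**  For number fields `K ⊆ E` with
`[K : ℚ] < [E : ℚ]` there is a sequence `f : ℕ → E` such that no term `f n` and no product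
`f m · f n` (`m ≠ n`) lies in `K^× · (E^×)²`, i.e. is of the form `q · c²` with `q ∈ K`, `c ∈ E`.
(So `E^×/(K^×·E^{×2})` is infinite.)  Ingredients: completely split primes (the tree's
Chebotarev-based `infinite_setOf_splitsCompletely`), `exists_two_primes_over_one`, finiteness of
the class group of `𝓞_E` (Mathlib), and the parity obstruction `not_exists_eq_mul_sq_of_odd`.
[cite: Marcus2018, Ch. 4 (before Thm. 29)] -/
theorem exists_seq_not_mem_relSquareClass (hlt : Module.finrank ℚ K < Module.finrank ℚ E) :
    ∃ f : ℕ → E, (∀ n, ¬ ∃ (q : K) (c : E), f n = algebraMap K E q * c ^ 2) ∧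
      ∀ m n, m ≠ n → ¬ ∃ (q : K) (c : E), f m * f n = algebraMap K E q * c ^ 2 := by
  classical
  -- infinitely many completely split primes
  set S : Set ℕ := {p : ℕ | p.Prime ∧ SplitsCompletely E p} with hSdef
  have hS : S.Infinite := infinite_setOf_splitsCompletely E
  haveI : Infinite S := hS.to_subtype
  -- above each: two primes of `E` over one prime of `K`
  have hdata : ∀ s : S, ∃ (v : HeightOneSpectrum (𝓞 K)) (w₁ w₂ : HeightOneSpectrum (𝓞 E)),
      w₁ ≠ w₂ ∧ ((s : ℕ) : 𝓞 E) ∈ w₁.asIdeal ∧ ((s : ℕ) : 𝓞 E) ∈ w₂.asIdeal ∧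
      w₁.asIdeal.LiesOver v.asIdeal ∧ w₂.asIdeal.LiesOver v.asIdeal ∧
      v.asIdeal.ramificationIdx' w₁.asIdeal = 1 ∧ v.asIdeal.ramificationIdx' w₂.asIdeal = 1 :=
    fun s => exists_two_primes_over_one hlt s.2.1 s.2.2
  choose v w₁ w₂ hne hp₁ hp₂ hl₁ hl₂ he₁ he₂ using hdata
  -- class-group pigeonhole on `s ↦ [w₁ s]`
  have hnz : ∀ s : S, (w₁ s).asIdeal ∈ (Ideal (𝓞 E))⁰ := fun s =>
    mem_nonZeroDivisors_of_ne_zero (w₁ s).ne_bot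
  let W : S → (Ideal (𝓞 E))⁰ := fun s => ⟨(w₁ s).asIdeal, hnz s⟩
  let g : S → ClassGroup (𝓞 E) := fun s => ClassGroup.mk0 (W s)
  obtain ⟨y, hy⟩ := Finite.exists_infinite_fiber g
  have hT : (g ⁻¹' {y}).Infinite := Set.infinite_coe_iff.mp hy
  obtain ⟨s₀, hs₀⟩ := hT.nonempty
  have hT' : (g ⁻¹' {y} \ {s₀}).Infinite := hT.sdiff (Set.finite_singleton s₀)
  let e : ℕ ↪ ↥(g ⁻¹' {y} \ {s₀}) := hT'.natEmbedding _
  -- the ideal `w₁ s * (w₁ s₀)^(h-1)` is principal for `s` in the fibre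
  set h : ℕ := Fintype.card (ClassGroup (𝓞 E)) with hhdef
  have hprinc : ∀ s : S, g s = y → ∃ x : 𝓞 E, x ≠ 0 ∧
      (w₁ s).asIdeal * (w₁ s₀).asIdeal ^ (h - 1) = Ideal.span {x} := by
    intro s hs
    have hs₀' : g s₀ = y := hs₀
    have hyh : y ^ h = 1 := by rw [hhdef]; exact pow_card_eq_one
    have hy' : y * y ^ (h - 1) = 1 := by
      rw [← pow_succ', Nat.sub_add_cancel Fintype.card_pos]; exact hyh
    have hinv : ClassGroup.mk0 (W s) = (ClassGroup.mk0 (W s₀ ^ (h - 1)))⁻¹ := by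
      rw [map_pow]
      change g s = (g s₀ ^ (h - 1))⁻¹
      rw [hs, hs₀', eq_inv_iff_mul_eq_one]
      exact hy'
    obtain ⟨x, hx0, hx⟩ := ClassGroup.mk0_eq_mk0_inv_iff.mp hinv
    refine ⟨x, hx0, ?_⟩
    simpa [W] using hx
  choose! π hπ0 hπ using hprinc
  -- the sequence
  let t : ℕ → S := fun n => ((e n : ↥(g ⁻¹' {y} \ {s₀})) : S)
  have ht : ∀ n, g (t n) = y ∧ t n ≠ s₀ := fun n => by
    have := (e n).2
    simp only [Set.mem_sdiff, Set.mem_preimage, Set.mem_singleton_iff] at this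
    exact this
  have htinj : Function.Injective t := fun m n hmn =>
    e.injective (Subtype.ext hmn)
  refine ⟨fun n => algebraMap (𝓞 E) E (π (t n)), ?_, ?_⟩
  · -- single terms
    intro n
    obtain ⟨hg, hns⟩ := ht n
    haveI := hl₁ (t n)
    haveI := hl₂ (t n)
    refine not_exists_eq_mul_sq_of_odd (v (t n)) (w₁ (t n)) (w₂ (t n)) (he₁ _) (he₂ _) ?_
    have hs₀ne : w₁ (t n) ≠ w₁ s₀ := by
      refine ne_of_natCast_mem (t n).2.1 s₀.2.1 ?_ (hp₁ (t n)) (hp₁ s₀)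
      exact fun h => hns (Subtype.ext h)
    rw [log_valuation_eq_neg_one (hπ (t n) hg).symm ?_, log_valuation_eq_zero (hπ (t n) hg).symm ?_]
    · decide
    · intro hd
      rcases eq_or_eq_of_dvd_mul_pow hd with h | h
      · exact hne (t n) h.symm
      · exact ne_of_natCast_mem (t n).2.1 s₀.2.1 (fun h' => hns (Subtype.ext h')) (hp₂ (t n))
          (hp₁ s₀) h
    · intro hd
      exact hs₀ne (eq_of_dvd ((w₁ (t n)).prime.dvd_of_dvd_pow hd))
  · -- products
    intro m n hmn
    obtain ⟨hgm, hms⟩ := ht m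
    obtain ⟨hgn, hns⟩ := ht n
    haveI := hl₁ (t m)
    haveI := hl₂ (t m)
    refine not_exists_eq_mul_sq_of_odd (v (t m)) (w₁ (t m)) (w₂ (t m)) (he₁ _) (he₂ _) ?_
    have htmn : (t m : ℕ) ≠ (t n : ℕ) := fun h => hmn (htinj (Subtype.ext h))
    have hπm0 : algebraMap (𝓞 E) E (π (t m)) ≠ 0 :=
      (map_ne_zero_iff _ (IsFractionRing.injective (𝓞 E) E)).mpr (hπ0 (t m) hgm)
    have hπn0 : algebraMap (𝓞 E) E (π (t n)) ≠ 0 :=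
      (map_ne_zero_iff _ (IsFractionRing.injective (𝓞 E) E)).mpr (hπ0 (t n) hgn)
    have hv₁ : ∀ w : HeightOneSpectrum (𝓞 E), w.valuation E (algebraMap (𝓞 E) E (π (t m))) ≠ 0 :=
      fun w => (Valuation.ne_zero_iff _).mpr hπm0
    have hv₂ : ∀ w : HeightOneSpectrum (𝓞 E), w.valuation E (algebraMap (𝓞 E) E (π (t n))) ≠ 0 :=
      fun w => (Valuation.ne_zero_iff _).mpr hπn0
    rw [map_mul, map_mul, log_mul (hv₁ _) (hv₂ _), log_mul (hv₁ _) (hv₂ _)]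
    -- valuations of `π (t m)` at `(w₁ (t m), w₂ (t m))`: `(-1, 0)`; of `π (t n)`: `(0, 0)`
    have hs₀m : w₁ (t m) ≠ w₁ s₀ :=
      ne_of_natCast_mem (t m).2.1 s₀.2.1 (fun h => hms (Subtype.ext h)) (hp₁ (t m)) (hp₁ s₀)
    rw [log_valuation_eq_neg_one (hπ (t m) hgm).symm ?_, log_valuation_eq_zero (hπ (t m) hgm).symm ?_,
      log_valuation_eq_zero (hπ (t n) hgn).symm ?_, log_valuation_eq_zero (hπ (t n) hgn).symm ?_]
    · decide
    · intro hd
      rcases eq_or_eq_of_dvd_mul_pow hd with h' | h'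
      · exact ne_of_natCast_mem (t m).2.1 (t n).2.1 htmn (hp₂ (t m)) (hp₁ (t n)) h'
      · exact ne_of_natCast_mem (t m).2.1 s₀.2.1 (fun h => hms (Subtype.ext h)) (hp₂ (t m))
          (hp₁ s₀) h'
    · intro hd
      rcases eq_or_eq_of_dvd_mul_pow hd with h' | h'
      · exact ne_of_natCast_mem (t m).2.1 (t n).2.1 htmn (hp₁ (t m)) (hp₁ (t n)) h'
      · exact hs₀m h'
    · intro hd
      rcases eq_or_eq_of_dvd_mul_pow hd with h' | h'
      · exact hne (t m) h'.symm
      · exact ne_of_natCast_mem (t m).2.1 s₀.2.1 (fun h => hms (Subtype.ext h)) (hp₂ (t m))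
          (hp₁ s₀) h'
    · intro hd
      exact hs₀m (eq_of_dvd ((w₁ (t m)).prime.dvd_of_dvd_pow hd))

end Literature.NumberTheory.NumberFields
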